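import Summits.HodgeConjecture.HodgeConjecture.Theorems.F0P3cStCharTSCartanDecompositionSkew   -- ★ (Q8) `skew_iff_tau_eq_neg` (τ-currency `τ X = J⁻¹ (X.map σ)ᵀ J`)
import Literature.LinearAlgebra.Matrix.SemisimpleAdRangeSupCommutant                          -- ★ (A′) `isCompl_ker_range_mulLeft_sub_mulRight_of_separable_aeval_eq_zero`
import Literature.LinearAlgebra.Matrix.UnitaryFormAdjointCayley                               -- ★ `formAdjoint_mul`, `formAdjoint_sub`
import Literature.LinearAlgebra.Matrix.CayleyCharpolyDiscr                                    -- ★ (D6b) `charpoly_coeff_fin_three`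
import Mathlib.RingTheory.Polynomial.Resultant.Basic
import Mathlib.LinearAlgebra.Matrix.Charpoly.Coeff
import HarnessLib

/-!
# F0 · P3c · line LH6 «StCharTS» — ROAD «HC-D» (in-house pay-down of the named input `hDGliO` of RUNG0 v2∕v3), brick (D4e)+(D5ii) «SEMISIMPLE DESCENT AT
# TYPE (a,a,b)», file A (ALGEBRA): the slice decomposition `𝔲 = 𝔠 ⊕ 𝔪` at a SKEW SEMISIMPLE `S₀`, its linear part `(Y, Z) ↦ 2[S₀, Y] + Z`, and the
# factorisation `disc(χ_{S₀+Z}) = disc(χ of the 2×2 block) · Res²` on the centraliser in normal form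

Cell `pub/hodgecm-mathlib`, crux H413 = `stmt-HodgeConjecture-24833` (lane `--supports … --as helper`), route HCCMUnconditional; seat F0P3a-p05 (g23), brick
(D4e)+(D5ii) of F0P2-p01 (g23)'s road «HC-D» (census `F0/P2/p01/g23/CENSUS-HCD.v1.F0P2p01g23.md` §1 (ii), §2 D4(e)∕D5; dealt 2026-09-02T16:11:14Z).
THEOREMS ONLY (no definition ∕ instance ∕ notation ∕ named fact ∕ `sorry`); imports ★ (Q8) + ★ (A′) + ★ `UnitaryFormAdjointCayley` + ★ (D6b) + Mathlib.
HONEST LABEL: HC_CM is proved only modulo the 7 printed citations (2 remaining: hLiu418 = `stmt-HodgeConjecture-24832`, h413 = `stmt-HodgeConjecture-24833`)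
until rung 0 closes; count-neutral linear algebra for the named input (HC-D) «`|D_G|^{−1∕2} ∈ L¹_loc(G)`» [HarishChandra1970, Part VII §1 Thm. 15] of the (S-𝔇) organ
`stub_EllipticPackage` of `Cruxes/H413/Lines/F0_P3c_StCharTSPaydown.lean`; closes no organ.

THE MATHEMATICS (Harish-Chandra's descent to the centraliser of a semisimple element, Lie-algebra version [HarishChandra1970, Part VI Lemma 22; Part VII §1];
[Rogawski1990, §8.2 Prop. 8.2.1 p. 112] for `U(3)`).  `K` a perfect field with involution `σ`, `J ∈ M_n(K)` invertible, `𝔲 = {X ∣ ᵗ(σX)J + JX = 0}` the `F`-Lie algebra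
of the unitary group of `J` (an `F`-submodule of `M_n(K)` given by its FIELD HYPOTHESIS `h𝔲`, road rule), `τ X := J⁻¹ ᵗ(σX) J` (so `X ∈ 𝔲 ⟺ τ X = −X`, ★ `skew_iff_tau_eq_neg`),
`ad S₀ := L_{S₀} − R_{S₀}` (the tree's `LinearMap.mulLeft K S₀ - LinearMap.mulRight K S₀`).  For `S₀ ∈ 𝔲` annihilated by a separable polynomial (e.g. `(X − a)(X − u)`,
`a ≠ u`: the semisimple NON-regular points of type `(a,a,b)` of the census):
* §1 `τ ∘ ad S₀ = ad S₀ ∘ τ` (`tau_commutator_of_skew`), so `τ` preserves `𝔠_K = ker ad S₀` and `𝔪_K = range ad S₀` (`tau_mem_ker_ad_of_skew`, `tau_mem_range_ad_of_skew`); with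
  ★ (A′) `M_n(K) = 𝔠_K ⊕ 𝔪_K` the uniqueness-of-splitting argument of ★ (Q8) `isCompl_cartan` gives **`𝔲 = 𝔠 ⊕ 𝔪`**, `𝔠 = 𝔲 ∩ 𝔠_K`, `𝔪 = 𝔲 ∩ 𝔪_K` (`isCompl_slice_skew`);
  `ad S₀` maps `𝔲` to `𝔲` (`commutator_mem_of_skew`), is injective on `𝔪_K` and maps `𝔲 ∩ 𝔪_K` ONTO itself (`exists_skew_preimage_of_mem_range`: if `ad S₀ Y = r` with `Y ∈ 𝔪_K`,
  `τ r = −r`, then `τ Y + Y ∈ 𝔠_K ∩ 𝔪_K = 0`); hence the LINEAR PART of the slice map `Ψ(Y, Z) = c(Y)(S₀ + Z)c(Y)⁻¹` (`c` the tree's Cayley transform, `Dc(0) = −2·id`),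
  **`e (Y, Z) = 2•(S₀Y − YS₀) + Z : (𝔲 ∩ 𝔪_K) × (𝔲 ∩ 𝔠_K) ≃ₗ[F] 𝔲`** is an `F`-linear ISOMORPHISM (`exists_sliceLinearEquiv`, `char K = 0`; delivered as an ∃-bundle, no definition);
* §2 NORMAL FORM `S₀ = diagonal ![a, a, b]`, `a ≠ b` (n = 3): `Z S₀ = S₀ Z ⟺ Z` is `(2,1)`-block-diagonal (`commute_diagonal_iff`), and for such `Z`
  **`disc(χ_{S₀+Z}) = q(Z) · Res(Z)²`** with `q(Z) = (Z₀₀ − Z₁₁)² + 4 Z₀₁Z₁₀ = disc(χ of the 2×2 block)` and `Res(Z) = χ_{a·1 + Z_a}(b + Z₂₂) = (b + Z₂₂ − a − Z₀₀)(b + Z₂₂ − a − Z₁₁) − Z₀₁Z₁₀`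
  (`discr_charpoly_diagonal_add_of_commute`; the case `deg q = 1` of `disc(pq) = disc p · disc q · Res(p,q)²`, proved denominator-free from Mathlib
  `discr_of_degree_eq_three` + ★ `charpoly_coeff_fin_three` by one `ring` identity), `Res(0) = (b − a)²` a UNIT (`res_zero_eq`).  On `𝔠 = 𝔲(J_a) ⊕ 𝔲(j_b)`
  the factor `q` is the discriminant form of the `U(2)`-block — file C docks it on D3b `|Q|^{−1∕2} ∈ L¹_loc(F³)` — and `|Res|` is locally constant `= |b − a|²` near `Z = 0`.
Files B∕C of the brick (slice map: strict derivative `e`, ★ FILE 2 `exists_depth_chart`, `η ∘ Ψ = η(S₀ + ·)`; assembly by Fubini) consume this file BY NAME.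

## References
* [HarishChandra1970] Harish-Chandra (notes by G. van Dijk), *Harmonic Analysis on Reductive p-adic Groups*, LNM 162 (1970), Part VI Lemma 22, Part VII §1 Thm. 15.
* [Rogawski1990] J. D. Rogawski, *Automorphic Representations of Unitary Groups in Three Variables*, Ann. of Math. Stud. 123 (1990), §8.2 Prop. 8.2.1 p. 112; §12.5 p. 182.
* [Borel1991] A. Borel, *Linear Algebraic Groups*, 2nd ed. (1991), I.4 (4.2, 4.4), III.9.1 (the centraliser of a semisimple element).
-/

set_option autoImplicit false
-- the mandated namespace has the single-problem summit's repeated segment (`HodgeConjecture.HodgeConjecture`)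
set_option linter.dupNamespace false

open Polynomial
open scoped Matrix
open Literature.LinearAlgebra.Matrix
open Summit.HodgeConjecture.HodgeConjecture.Cruxes.H413.F0P3cStCharTSCartanDecompositionSkew

namespace Summit.HodgeConjecture.HodgeConjecture.Cruxes.H413.F0P3cStCharTSHCDescentSemisimpleAlg

/-! ## §1 The slice decomposition `𝔲 = 𝔠 ⊕ 𝔪` at a skew semisimple `S₀` and its linear part -/

section Slice

variable {K : Type*} [Field K] {n : Type*} [Fintype n] [DecidableEq n] (σ : K →+* K) (J : Matrix n n K) (hJ : IsUnit J.det)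
include hJ

/-- **`τ ∘ ad S₀ = ad S₀ ∘ τ` for skew `S₀`:** `τ(S₀X − XS₀) = S₀·τX − τX·S₀` (`τ` is an anti-homomorphism with `τ S₀ = −S₀`). [cite: Borel1991, III.9.1] -/
theorem tau_commutator_of_skew {S₀ : Matrix n n K} (hS : (S₀.map σ)ᵀ * J + J * S₀ = 0) (X : Matrix n n K) :
    J⁻¹ * ((S₀ * X - X * S₀).map σ)ᵀ * J = S₀ * (J⁻¹ * (X.map σ)ᵀ * J) - (J⁻¹ * (X.map σ)ᵀ * J) * S₀ := by
  have hτS : J⁻¹ * (S₀.map σ)ᵀ * J = -S₀ := (skew_iff_tau_eq_neg σ J hJ S₀).1 hS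
  rw [formAdjoint_sub σ, formAdjoint_mul σ hJ, formAdjoint_mul σ hJ, hτS]
  simp only [Matrix.mul_neg, Matrix.neg_mul]
  abel

/-- `τ` preserves the centraliser `𝔠_K = ker ad S₀` of a skew `S₀`. [cite: Borel1991, III.9.1] -/
theorem tau_mem_ker_ad_of_skew {S₀ : Matrix n n K} (hS : (S₀.map σ)ᵀ * J + J * S₀ = 0) {X : Matrix n n K}
    (hX : X ∈ LinearMap.ker (LinearMap.mulLeft K S₀ - LinearMap.mulRight K S₀ : Module.End K (Matrix n n K))) :
    J⁻¹ * (X.map σ)ᵀ * J ∈ LinearMap.ker (LinearMap.mulLeft K S₀ - LinearMap.mulRight K S₀ : Module.End K (Matrix n n K)) := by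
  simp only [LinearMap.mem_ker, LinearMap.sub_apply, LinearMap.mulLeft_apply, LinearMap.mulRight_apply] at hX ⊢
  rw [← tau_commutator_of_skew σ J hJ hS X, hX, Matrix.map_zero σ (map_zero σ), Matrix.transpose_zero, Matrix.mul_zero, Matrix.zero_mul]

/-- `τ` preserves the slice `𝔪_K = range ad S₀` of a skew `S₀`: `τ(S₀Y − YS₀) = S₀(τY) − (τY)S₀`. [cite: Borel1991, III.9.1] -/
theorem tau_mem_range_ad_of_skew {S₀ : Matrix n n K} (hS : (S₀.map σ)ᵀ * J + J * S₀ = 0) {X : Matrix n n K}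
    (hX : X ∈ LinearMap.range (LinearMap.mulLeft K S₀ - LinearMap.mulRight K S₀ : Module.End K (Matrix n n K))) :
    J⁻¹ * (X.map σ)ᵀ * J ∈ LinearMap.range (LinearMap.mulLeft K S₀ - LinearMap.mulRight K S₀ : Module.End K (Matrix n n K)) := by
  obtain ⟨Y, rfl⟩ := hX
  refine ⟨J⁻¹ * (Y.map σ)ᵀ * J, ?_⟩
  simp only [LinearMap.sub_apply, LinearMap.mulLeft_apply, LinearMap.mulRight_apply]
  exact (tau_commutator_of_skew σ J hJ hS Y).symm

omit [DecidableEq n] hJ in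
/-- **`ad S₀` maps `𝔲` to `𝔲`:** the commutator of two skew matrices is skew. [cite: Borel1991, III.9.1] -/
theorem commutator_mem_of_skew {S₀ X : Matrix n n K} (hS : (S₀.map σ)ᵀ * J + J * S₀ = 0) (hX : (X.map σ)ᵀ * J + J * X = 0) :
    ((S₀ * X - X * S₀).map σ)ᵀ * J + J * (S₀ * X - X * S₀) = 0 := by
  rw [add_eq_zero_iff_eq_neg] at hS hX
  rw [Matrix.map_sub _ (map_sub σ), Matrix.map_mul, Matrix.map_mul, Matrix.transpose_sub, Matrix.transpose_mul, Matrix.transpose_mul,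
    Matrix.sub_mul, Matrix.mul_assoc, hS, Matrix.mul_assoc, hX, Matrix.mul_neg, Matrix.mul_neg, ← Matrix.mul_assoc, ← Matrix.mul_assoc, hX, hS,
    Matrix.mul_sub]
  simp only [Matrix.neg_mul, Matrix.mul_assoc]
  abel

variable {F : Type*} [Field F] [Algebra F K]

/-- **THE SLICE DECOMPOSITION `𝔲 = 𝔠 ⊕ 𝔪` AT A SKEW SEMISIMPLE `S₀`** (`𝔠 = 𝔲 ∩ ker ad S₀`, `𝔪 = 𝔲 ∩ range ad S₀`, as `F`-submodules of `↥𝔲`; `S₀` skew and annihilated by a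
separable polynomial, `K` perfect, `J` invertible).  The `K`-splitting `X = k + r` (★ (A′)) of `X ∈ 𝔲` has `τ k ∈ 𝔠_K`, `τ r ∈ 𝔪_K` (§1) and `τ X = −X`, so `τ k = −k`,
`τ r = −r` by uniqueness — both parts are skew (the proof of ★ (Q8) `isCompl_cartan` with `Ad t₀` ↦ `ad S₀`).
[cite: HarishChandra1970, Part VI Lemma 22] [cite: Borel1991, III.9.1] [cite: Rogawski1990, §8.2 Prop. 8.2.1 p. 112] -/
theorem isCompl_slice_skew [PerfectField K] (𝔲 : Submodule F (Matrix n n K)) (h𝔲 : ∀ X : Matrix n n K, X ∈ 𝔲 ↔ (X.map σ)ᵀ * J + J * X = 0)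
    {S₀ : Matrix n n K} (hS : (S₀.map σ)ᵀ * J + J * S₀ = 0) {p : K[X]} (hp : p.Separable) (hpS : aeval S₀ p = 0) :
    IsCompl (((LinearMap.ker (LinearMap.mulLeft K S₀ - LinearMap.mulRight K S₀ : Module.End K (Matrix n n K))).restrictScalars F).comap 𝔲.subtype)
      (((LinearMap.range (LinearMap.mulLeft K S₀ - LinearMap.mulRight K S₀ : Module.End K (Matrix n n K))).restrictScalars F).comap 𝔲.subtype) := by
  have hK := isCompl_ker_range_mulLeft_sub_mulRight_of_separable_aeval_eq_zero S₀ hp hpS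
  refine ⟨?_, ?_⟩
  · rw [Submodule.disjoint_def]
    intro X hX1 hX2
    rw [Submodule.mem_comap, Submodule.restrictScalars_mem] at hX1 hX2
    have h := hK.disjoint
    rw [Submodule.disjoint_def] at h
    exact Subtype.ext (h _ hX1 hX2)
  · rw [codisjoint_iff, eq_top_iff]
    rintro X -
    have hX := (h𝔲 (X : Matrix n n K)).1 X.2
    -- the `K`-splitting of `↑X`
    have htop : (X : Matrix n n K) ∈ LinearMap.ker (LinearMap.mulLeft K S₀ - LinearMap.mulRight K S₀ : Module.End K (Matrix n n K)) ⊔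
        LinearMap.range (LinearMap.mulLeft K S₀ - LinearMap.mulRight K S₀ : Module.End K (Matrix n n K)) := by
      rw [hK.sup_eq_top]; exact Submodule.mem_top
    obtain ⟨k, hk, r, hr, hkr⟩ := Submodule.mem_sup.1 htop
    -- `τ` preserves `𝔠_K` and `𝔪_K`
    have hτk : -(J⁻¹ * (k.map σ)ᵀ * J) ∈ LinearMap.ker (LinearMap.mulLeft K S₀ - LinearMap.mulRight K S₀ : Module.End K (Matrix n n K)) :=
      Submodule.neg_mem _ (tau_mem_ker_ad_of_skew σ J hJ hS hk)
    have hτr : -(J⁻¹ * (r.map σ)ᵀ * J) ∈ LinearMap.range (LinearMap.mulLeft K S₀ - LinearMap.mulRight K S₀ : Module.End K (Matrix n n K)) :=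
      Submodule.neg_mem _ (tau_mem_range_ad_of_skew σ J hJ hS hr)
    -- uniqueness of the splitting: `−X = τ k + τ r = (−k) + (−r)`
    have hτX : J⁻¹ * ((X : Matrix n n K).map σ)ᵀ * J = -(X : Matrix n n K) := (skew_iff_tau_eq_neg σ J hJ _).1 hX
    have hsum : (-(J⁻¹ * (k.map σ)ᵀ * J) - k) + (-(J⁻¹ * (r.map σ)ᵀ * J) - r) = 0 := by
      have h : J⁻¹ * ((X : Matrix n n K).map σ)ᵀ * J = J⁻¹ * (k.map σ)ᵀ * J + J⁻¹ * (r.map σ)ᵀ * J := by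
        rw [← hkr, Matrix.map_add _ (map_add σ), Matrix.transpose_add, Matrix.mul_add, Matrix.add_mul]
      rw [hτX, ← hkr] at h
      rw [show (-(J⁻¹ * (k.map σ)ᵀ * J) - k) + (-(J⁻¹ * (r.map σ)ᵀ * J) - r) = -((J⁻¹ * (k.map σ)ᵀ * J + J⁻¹ * (r.map σ)ᵀ * J) + (k + r)) by abel, ← h,
        neg_add_cancel, neg_zero]
    have hd := hK.disjoint
    rw [Submodule.disjoint_def] at hd
    have hkk : -(J⁻¹ * (k.map σ)ᵀ * J) - k = 0 := by
      refine hd _ (Submodule.sub_mem _ hτk hk) ?_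
      have : -(J⁻¹ * (k.map σ)ᵀ * J) - k = -((-(J⁻¹ * (r.map σ)ᵀ * J) - r)) := by rw [← add_eq_zero_iff_eq_neg]; exact hsum
      rw [this]
      exact Submodule.neg_mem _ (Submodule.sub_mem _ hτr hr)
    have hrr : -(J⁻¹ * (r.map σ)ᵀ * J) - r = 0 := by rw [hkk, zero_add] at hsum; exact hsum
    -- hence `k`, `r` are skew
    have hk𝔲 : k ∈ 𝔲 := (h𝔲 k).2 ((skew_iff_tau_eq_neg σ J hJ k).2 (by rw [sub_eq_zero] at hkk; exact neg_eq_iff_eq_neg.1 hkk))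
    have hr𝔲 : r ∈ 𝔲 := (h𝔲 r).2 ((skew_iff_tau_eq_neg σ J hJ r).2 (by rw [sub_eq_zero] at hrr; exact neg_eq_iff_eq_neg.1 hrr))
    have hXeq : X = (⟨k, hk𝔲⟩ : ↥𝔲) + ⟨r, hr𝔲⟩ := Subtype.ext hkr.symm
    rw [hXeq]
    exact Submodule.add_mem_sup (by rw [Submodule.mem_comap, Submodule.restrictScalars_mem]; exact hk)
      (by rw [Submodule.mem_comap, Submodule.restrictScalars_mem]; exact hr)

omit hJ in
/-- `𝔠 = 𝔲 ∩ ker ad S₀` read as commutation: `X ∈ 𝔠 ↔ S₀ ↑X = ↑X S₀`. [cite: Borel1991, III.9.1] -/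
theorem mem_sliceFixed_iff (𝔲 : Submodule F (Matrix n n K)) (S₀ : Matrix n n K) (X : ↥𝔲) :
    X ∈ (((LinearMap.ker (LinearMap.mulLeft K S₀ - LinearMap.mulRight K S₀ : Module.End K (Matrix n n K))).restrictScalars F).comap 𝔲.subtype) ↔
      S₀ * (X : Matrix n n K) = (X : Matrix n n K) * S₀ := by
  rw [Submodule.mem_comap, Submodule.restrictScalars_mem, Submodule.subtype_apply, LinearMap.mem_ker, LinearMap.sub_apply, LinearMap.mulLeft_apply,
    LinearMap.mulRight_apply, sub_eq_zero]

omit hJ in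
/-- **`ad S₀` is injective on `𝔪_K = range ad S₀`** (`S₀` annihilated by a separable polynomial, `K` perfect): `ker ∩ range = 0`. [cite: Borel1991, I.4 (4.2, 4.4)] -/
theorem eq_zero_of_mem_range_of_commutator_eq_zero [PerfectField K] {S₀ : Matrix n n K} {p : K[X]} (hp : p.Separable) (hpS : aeval S₀ p = 0)
    {Y : Matrix n n K} (hY : Y ∈ LinearMap.range (LinearMap.mulLeft K S₀ - LinearMap.mulRight K S₀ : Module.End K (Matrix n n K)))
    (h0 : S₀ * Y - Y * S₀ = 0) : Y = 0 := by
  have hd := (isCompl_ker_range_mulLeft_sub_mulRight_of_separable_aeval_eq_zero S₀ hp hpS).disjoint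
  rw [Submodule.disjoint_def] at hd
  refine hd Y ?_ hY
  rw [LinearMap.mem_ker, LinearMap.sub_apply, LinearMap.mulLeft_apply, LinearMap.mulRight_apply]
  exact h0

/-- **`ad S₀` maps `𝔲 ∩ 𝔪_K` ONTO `𝔲 ∩ 𝔪_K`:** every skew `r ∈ range ad S₀` is `S₀Y − YS₀` for a SKEW `Y ∈ range ad S₀` (write `r = ad Y` with `Y ∈ 𝔪_K` by ★ (A′); then
`ad (τY + Y) = τ r + r = 0` and `τY + Y ∈ 𝔪_K`, so `τ Y = −Y`). [cite: HarishChandra1970, Part VI Lemma 22] [cite: Borel1991, III.9.1] -/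
theorem exists_skew_preimage_of_mem_range [PerfectField K] {S₀ : Matrix n n K} (hS : (S₀.map σ)ᵀ * J + J * S₀ = 0) {p : K[X]} (hp : p.Separable)
    (hpS : aeval S₀ p = 0) {r : Matrix n n K} (hr𝔲 : (r.map σ)ᵀ * J + J * r = 0)
    (hr : r ∈ LinearMap.range (LinearMap.mulLeft K S₀ - LinearMap.mulRight K S₀ : Module.End K (Matrix n n K))) :
    ∃ Y : Matrix n n K, (Y.map σ)ᵀ * J + J * Y = 0 ∧
      Y ∈ LinearMap.range (LinearMap.mulLeft K S₀ - LinearMap.mulRight K S₀ : Module.End K (Matrix n n K)) ∧ S₀ * Y - Y * S₀ = r := by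
  have hK := isCompl_ker_range_mulLeft_sub_mulRight_of_separable_aeval_eq_zero S₀ hp hpS
  obtain ⟨Y₀, hY₀⟩ := hr
  -- split the preimage `Y₀ = k + Y` along `M_n(K) = 𝔠_K ⊕ 𝔪_K`; `ad Y₀ = ad Y`
  have htop : Y₀ ∈ LinearMap.ker (LinearMap.mulLeft K S₀ - LinearMap.mulRight K S₀ : Module.End K (Matrix n n K)) ⊔
      LinearMap.range (LinearMap.mulLeft K S₀ - LinearMap.mulRight K S₀ : Module.End K (Matrix n n K)) := by
    rw [hK.sup_eq_top]; exact Submodule.mem_top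
  obtain ⟨k, hk, Y, hY, hkY⟩ := Submodule.mem_sup.1 htop
  have hadY : S₀ * Y - Y * S₀ = r := by
    rw [LinearMap.mem_ker, LinearMap.sub_apply, LinearMap.mulLeft_apply, LinearMap.mulRight_apply] at hk
    rw [← hkY, LinearMap.sub_apply, LinearMap.mulLeft_apply, LinearMap.mulRight_apply, Matrix.mul_add, Matrix.add_mul] at hY₀
    rw [← hY₀, add_sub_add_comm, hk, zero_add]
  refine ⟨Y, ?_, hY, hadY⟩
  -- `τY + Y ∈ 𝔠_K ∩ 𝔪_K = 0`
  have hτr : J⁻¹ * (r.map σ)ᵀ * J = -r := (skew_iff_tau_eq_neg σ J hJ r).1 hr𝔲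
  have hsum_range : J⁻¹ * (Y.map σ)ᵀ * J + Y ∈ LinearMap.range (LinearMap.mulLeft K S₀ - LinearMap.mulRight K S₀ : Module.End K (Matrix n n K)) :=
    Submodule.add_mem _ (tau_mem_range_ad_of_skew σ J hJ hS hY) hY
  have hsum_zero : S₀ * (J⁻¹ * (Y.map σ)ᵀ * J + Y) - (J⁻¹ * (Y.map σ)ᵀ * J + Y) * S₀ = 0 := by
    rw [Matrix.mul_add, Matrix.add_mul, add_sub_add_comm, ← tau_commutator_of_skew σ J hJ hS Y, hadY, hτr, neg_add_cancel]
  have h0 := eq_zero_of_mem_range_of_commutator_eq_zero (hp := hp) (hpS := hpS) hsum_range hsum_zero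
  exact (skew_iff_tau_eq_neg σ J hJ Y).2 (eq_neg_of_add_eq_zero_left h0)

/-- **THE LINEAR PART OF THE SLICE MAP IS AN ISOMORPHISM** (∃-bundle, no definition): for `𝔲` (field hypothesis), `J` invertible, `S₀` skew annihilated by a separable
polynomial, `K` perfect of characteristic `0`, there is an `F`-linear equivalence `e : (𝔲 ∩ 𝔪_K) × (𝔲 ∩ 𝔠_K) ≃ₗ[F] 𝔲` with **`e (Y, Z) = 2•(S₀Y − YS₀) + Z`** — the
derivative at `0` of `(Y, Z) ↦ c(Y)(S₀ + Z)c(Y)⁻¹` for the tree's Cayley transform `c(Y) = (1 − Y)(1 + Y)⁻¹` (`Dc(0) = −2·id`, ★ `hasStrictFDerivAt_cayley_zero`); injective since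
`2[S₀,Y] = −Z ∈ 𝔠_K ∩ 𝔪_K = 0`, surjective by `𝔲 = 𝔠 ⊕ 𝔪` and `ad S₀ (𝔲 ∩ 𝔪_K) = 𝔲 ∩ 𝔪_K`. [cite: HarishChandra1970, Part VI Lemma 22] [cite: Borel1991, III.9.1] -/
theorem exists_sliceLinearEquiv [PerfectField K] [CharZero K] (𝔲 : Submodule F (Matrix n n K))
    (h𝔲 : ∀ X : Matrix n n K, X ∈ 𝔲 ↔ (X.map σ)ᵀ * J + J * X = 0)
    {S₀ : Matrix n n K} (hS : (S₀.map σ)ᵀ * J + J * S₀ = 0) {p : K[X]} (hp : p.Separable) (hpS : aeval S₀ p = 0) :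
    ∃ e : (↥(𝔲 ⊓ (LinearMap.range (LinearMap.mulLeft K S₀ - LinearMap.mulRight K S₀ : Module.End K (Matrix n n K))).restrictScalars F) ×
            ↥(𝔲 ⊓ (LinearMap.ker (LinearMap.mulLeft K S₀ - LinearMap.mulRight K S₀ : Module.End K (Matrix n n K))).restrictScalars F)) ≃ₗ[F] ↥𝔲,
      ∀ q, ((e q : ↥𝔲) : Matrix n n K) = (2 : K) • (S₀ * (q.1 : Matrix n n K) - (q.1 : Matrix n n K) * S₀) + (q.2 : Matrix n n K) := by
  have hK := isCompl_ker_range_mulLeft_sub_mulRight_of_separable_aeval_eq_zero S₀ hp hpS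
  -- the candidate map, `F`-linear into `𝔲`
  have hmem : ∀ q : ↥(𝔲 ⊓ (LinearMap.range (LinearMap.mulLeft K S₀ - LinearMap.mulRight K S₀ : Module.End K (Matrix n n K))).restrictScalars F) ×
      ↥(𝔲 ⊓ (LinearMap.ker (LinearMap.mulLeft K S₀ - LinearMap.mulRight K S₀ : Module.End K (Matrix n n K))).restrictScalars F),
      (2 : K) • (S₀ * (q.1 : Matrix n n K) - (q.1 : Matrix n n K) * S₀) + (q.2 : Matrix n n K) ∈ 𝔲 := by
    intro q
    refine 𝔲.add_mem ?_ (Submodule.mem_inf.1 q.2.2).1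
    have h1 : S₀ * (q.1 : Matrix n n K) - (q.1 : Matrix n n K) * S₀ ∈ 𝔲 :=
      (h𝔲 _).2 (commutator_mem_of_skew σ J hS ((h𝔲 _).1 (Submodule.mem_inf.1 q.1.2).1))
    have h2 : (2 : K) • (S₀ * (q.1 : Matrix n n K) - (q.1 : Matrix n n K) * S₀) = (2 : F) • (S₀ * (q.1 : Matrix n n K) - (q.1 : Matrix n n K) * S₀) := by
      rw [← map_ofNat (algebraMap F K) 2, algebraMap_smul]
    rw [h2]
    exact 𝔲.smul_mem _ h1
  let f : (↥(𝔲 ⊓ (LinearMap.range (LinearMap.mulLeft K S₀ - LinearMap.mulRight K S₀ : Module.End K (Matrix n n K))).restrictScalars F) ×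
      ↥(𝔲 ⊓ (LinearMap.ker (LinearMap.mulLeft K S₀ - LinearMap.mulRight K S₀ : Module.End K (Matrix n n K))).restrictScalars F)) →ₗ[F] ↥𝔲 :=
    { toFun := fun q => ⟨(2 : K) • (S₀ * (q.1 : Matrix n n K) - (q.1 : Matrix n n K) * S₀) + (q.2 : Matrix n n K), hmem q⟩
      map_add' := fun q q' => by
        apply Subtype.ext
        simp only [Prod.fst_add, Prod.snd_add, Submodule.coe_add, Matrix.mul_add, Matrix.add_mul, smul_add, smul_sub]
        abel
      map_smul' := fun c q => by
        apply Subtype.ext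
        simp only [Prod.smul_fst, Prod.smul_snd, Submodule.coe_smul, RingHom.id_apply, Algebra.mul_smul_comm, Algebra.smul_mul_assoc, smul_add,
          smul_sub, smul_comm c (2 : K)] }
  have hf : ∀ q, ((f q : ↥𝔲) : Matrix n n K) = (2 : K) • (S₀ * (q.1 : Matrix n n K) - (q.1 : Matrix n n K) * S₀) + (q.2 : Matrix n n K) := fun q => rfl
  refine ⟨LinearEquiv.ofBijective f ⟨?_, ?_⟩, fun q => by rw [LinearEquiv.ofBijective_apply, hf]⟩
  · -- injective: `2[S₀,Y] = −Z ∈ 𝔠_K ∩ 𝔪_K`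
    rw [injective_iff_map_eq_zero]
    intro q hq
    have hq' : (2 : K) • (S₀ * (q.1 : Matrix n n K) - (q.1 : Matrix n n K) * S₀) + (q.2 : Matrix n n K) = 0 := by
      rw [← hf, hq, Submodule.coe_zero]
    have hY : (q.1 : Matrix n n K) ∈ LinearMap.range (LinearMap.mulLeft K S₀ - LinearMap.mulRight K S₀ : Module.End K (Matrix n n K)) :=
      (Submodule.mem_inf.1 q.1.2).2
    have hZ : (q.2 : Matrix n n K) ∈ LinearMap.ker (LinearMap.mulLeft K S₀ - LinearMap.mulRight K S₀ : Module.End K (Matrix n n K)) :=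
      (Submodule.mem_inf.1 q.2.2).2
    have hcomm : (2 : K) • (S₀ * (q.1 : Matrix n n K) - (q.1 : Matrix n n K) * S₀) ∈
        LinearMap.range (LinearMap.mulLeft K S₀ - LinearMap.mulRight K S₀ : Module.End K (Matrix n n K)) :=
      Submodule.smul_mem _ _ ⟨(q.1 : Matrix n n K), by rw [LinearMap.sub_apply, LinearMap.mulLeft_apply, LinearMap.mulRight_apply]⟩
    have hd := hK.disjoint
    rw [Submodule.disjoint_def] at hd
    -- `Z = −2[S₀,Y] ∈ 𝔠_K ∩ 𝔪_K`
    have hZ0 : (q.2 : Matrix n n K) = 0 := by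
      refine hd _ hZ ?_
      have : (q.2 : Matrix n n K) = -((2 : K) • (S₀ * (q.1 : Matrix n n K) - (q.1 : Matrix n n K) * S₀)) := eq_neg_of_add_eq_zero_right hq'
      rw [this]
      exact Submodule.neg_mem _ hcomm
    have hY0' : S₀ * (q.1 : Matrix n n K) - (q.1 : Matrix n n K) * S₀ = 0 := by
      rw [hZ0, add_zero] at hq'
      exact (smul_eq_zero.1 hq').resolve_left two_ne_zero
    have hY0 : (q.1 : Matrix n n K) = 0 := eq_zero_of_mem_range_of_commutator_eq_zero (hp := hp) (hpS := hpS) hY hY0'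
    exact Prod.ext (Subtype.ext hY0) (Subtype.ext hZ0)
  · -- surjective: split `X = k + r` in `𝔲 = 𝔠 ⊕ 𝔪` and solve `2[S₀,Y] = r` with a skew `Y ∈ 𝔪_K`
    intro X
    have hc := isCompl_slice_skew σ J hJ 𝔲 h𝔲 hS hp hpS
    have htop : X ∈ (((LinearMap.ker (LinearMap.mulLeft K S₀ - LinearMap.mulRight K S₀ : Module.End K (Matrix n n K))).restrictScalars F).comap 𝔲.subtype) ⊔
        (((LinearMap.range (LinearMap.mulLeft K S₀ - LinearMap.mulRight K S₀ : Module.End K (Matrix n n K))).restrictScalars F).comap 𝔲.subtype) := by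
      rw [hc.sup_eq_top]; exact Submodule.mem_top
    obtain ⟨k, hk, r, hr, hkr⟩ := Submodule.mem_sup.1 htop
    rw [Submodule.mem_comap, Submodule.restrictScalars_mem, Submodule.subtype_apply] at hk hr
    obtain ⟨Y, hY𝔲, hY, hadY⟩ := exists_skew_preimage_of_mem_range σ J hJ hS hp hpS ((h𝔲 _).1 r.2) hr
    refine ⟨(⟨(2 : K)⁻¹ • Y, Submodule.mem_inf.2 ⟨?_, Submodule.smul_mem _ _ hY⟩⟩, ⟨(k : Matrix n n K), Submodule.mem_inf.2 ⟨k.2, hk⟩⟩), ?_⟩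
    · have h2 : (2 : K)⁻¹ • Y = (2 : F)⁻¹ • Y := by
        rw [← map_ofNat (algebraMap F K) 2, ← map_inv₀, algebraMap_smul]
      rw [h2]
      exact 𝔲.smul_mem _ ((h𝔲 Y).2 hY𝔲)
    · apply Subtype.ext
      rw [hf, ← hkr, Submodule.coe_add]
      simp only [Matrix.mul_smul, Matrix.smul_mul, ← smul_sub, smul_smul, mul_inv_cancel₀ (two_ne_zero : (2 : K) ≠ 0), one_smul, hadY]
      exact add_comm _ _

end Slice

/-! ## §2 Normal form `S₀ = diagonal ![a, a, b]`: the centraliser is block-diagonal and `disc(χ_{S₀+Z}) = disc(block) · Res²` -/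

section NormalForm

variable {R : Type*} [CommRing R]

/-- **The centraliser of `diag(a, a, b)`, `a − b` a non-zero-divisor (e.g. `a ≠ b` in a field): `Z S₀ = S₀ Z ⟺ Z` is `(2,1)`-block-diagonal**
(`Z₀₂ = Z₁₂ = Z₂₀ = Z₂₁ = 0`). [cite: Borel1991, III.9.1] -/
theorem commute_diagonal_iff {a b : R} (hab : ∀ x : R, (a - b) * x = 0 → x = 0) (Z : Matrix (Fin 3) (Fin 3) R) :
    Matrix.diagonal ![a, a, b] * Z = Z * Matrix.diagonal ![a, a, b] ↔ Z 0 2 = 0 ∧ Z 1 2 = 0 ∧ Z 2 0 = 0 ∧ Z 2 1 = 0 := by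
  constructor
  · intro h
    have e : ∀ i j : Fin 3, (![a, a, b] i) * Z i j = Z i j * (![a, a, b] j) := fun i j => by
      have := congrFun (congrFun h i) j
      simpa [Matrix.diagonal_mul, Matrix.mul_diagonal] using this
    have h02 := e 0 2; have h12 := e 1 2; have h20 := e 2 0; have h21 := e 2 1
    simp only [Matrix.cons_val_zero, Matrix.cons_val_one, Matrix.cons_val] at h02 h12 h20 h21
    refine ⟨hab _ ?_, hab _ ?_, hab _ ?_, hab _ ?_⟩
    · linear_combination h02
    · linear_combination h12
    · linear_combination -h20
    · linear_combination -h21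
  · rintro ⟨h02, h12, h20, h21⟩
    ext i j
    simp only [Matrix.diagonal_mul, Matrix.mul_diagonal]
    fin_cases i <;> fin_cases j <;> simp [h02, h12, h20, h21, mul_comm]

/-- **`disc(χ_{S₀+Z}) = q(Z)·Res(Z)²` on the centraliser of `S₀ = diag(a, a, b)`** (`Z` block-diagonal): with the `2×2` block `a·1 + Z_a` and the corner `b + Z₂₂`,
`χ_{S₀+Z} = χ_{a·1+Z_a} · (X − (b + Z₂₂))` and `disc = disc(χ_{a·1+Z_a}) · χ_{a·1+Z_a}(b + Z₂₂)²`, i.e.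
`q(Z) = (Z₀₀ − Z₁₁)² + 4Z₀₁Z₁₀` (`= (tr)² − 4 det` of the block, shift-invariant) and `Res(Z) = (b + Z₂₂ − a − Z₀₀)(b + Z₂₂ − a − Z₁₁) − Z₀₁Z₁₀` — the case `deg = 2 + 1` of
`disc(pq) = disc p · disc q · Res(p,q)²`, proved denominator-free from the cubic discriminant formula (any commutative ring).
[cite: HarishChandra1970, Part VII §1 Thm. 15] [cite: Rogawski1990, §12.5 p. 182; §4.9 p. 54] -/
theorem discr_charpoly_diagonal_add_of_commute (a b : R) (Z : Matrix (Fin 3) (Fin 3) R) (h02 : Z 0 2 = 0) (h12 : Z 1 2 = 0) (h20 : Z 2 0 = 0)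
    (h21 : Z 2 1 = 0) :
    (Matrix.diagonal ![a, a, b] + Z).charpoly.discr =
      ((Z 0 0 - Z 1 1) ^ 2 + 4 * (Z 0 1 * Z 1 0)) * ((b + Z 2 2 - a - Z 0 0) * (b + Z 2 2 - a - Z 1 1) - Z 0 1 * Z 1 0) ^ 2 := by
  nontriviality R
  set M := Matrix.diagonal ![a, a, b] + Z with hM
  have hdeg : M.charpoly.degree = 3 := by rw [Matrix.charpoly_degree_eq_dim]; rfl
  obtain ⟨h3, h2, h1, h0⟩ := charpoly_coeff_fin_three M
  have e00 : M 0 0 = a + Z 0 0 := by simp [hM]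
  have e11 : M 1 1 = a + Z 1 1 := by simp [hM]
  have e22 : M 2 2 = b + Z 2 2 := by simp [hM]
  have e01 : M 0 1 = Z 0 1 := by simp [hM]
  have e10 : M 1 0 = Z 1 0 := by simp [hM]
  have e02 : M 0 2 = 0 := by simp [hM, h02]
  have e12 : M 1 2 = 0 := by simp [hM, h12]
  have e20 : M 2 0 = 0 := by simp [hM, h20]
  have e21 : M 2 1 = 0 := by simp [hM, h21]
  rw [discr_of_degree_eq_three hdeg, h3, h2, h1, h0, e00, e11, e22, e01, e10, e02, e12, e20, e21]
  ring

/-- The resultant factor at `Z = 0` is `(b − a)²` (a unit when `a ≠ b` in a field), the block factor vanishes: `disc(χ_{S₀}) = 0 · (b − a)⁴`. [cite: Rogawski1990, §12.5 p. 184] -/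
theorem res_zero_eq (a b : R) :
    ((b + (0 : Matrix (Fin 3) (Fin 3) R) 2 2 - a - (0 : Matrix (Fin 3) (Fin 3) R) 0 0) *
        (b + (0 : Matrix (Fin 3) (Fin 3) R) 2 2 - a - (0 : Matrix (Fin 3) (Fin 3) R) 1 1) -
      (0 : Matrix (Fin 3) (Fin 3) R) 0 1 * (0 : Matrix (Fin 3) (Fin 3) R) 1 0) = (b - a) ^ 2 := by
  simp only [Matrix.zero_apply]; ring

/-- `disc(χ_{diag(a,a,b)}) = 0` (the semisimple NON-regular point lies on the discriminant locus). [cite: Rogawski1990, §12.5 p. 184] -/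
theorem discr_charpoly_diagonal_aab (a b : R) : (Matrix.diagonal ![a, a, b]).charpoly.discr = 0 := by
  have h := discr_charpoly_diagonal_add_of_commute a b 0 rfl rfl rfl rfl
  rw [add_zero] at h
  rw [h]
  simp only [Matrix.zero_apply]; ring

/-- **The block factor is the discriminant of the `2×2` block:** for `B : M₂(R)`, `disc(χ_B) = (B₀₀ − B₁₁)² + 4B₀₁B₁₀` and it is invariant under `B ↦ a·1 + B`.
[cite: Rogawski1990, §12.5 p. 184] -/
theorem discr_charpoly_fin_two (B : Matrix (Fin 2) (Fin 2) R) :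
    B.charpoly.discr = (B 0 0 - B 1 1) ^ 2 + 4 * (B 0 1 * B 1 0) ∧ ∀ a : R, (a • (1 : Matrix (Fin 2) (Fin 2) R) + B).charpoly.discr = B.charpoly.discr := by
  nontriviality R
  have key : ∀ B : Matrix (Fin 2) (Fin 2) R, B.charpoly.discr = (B 0 0 - B 1 1) ^ 2 + 4 * (B 0 1 * B 1 0) := by
    intro B
    have hdeg : B.charpoly.degree = 2 := by rw [Matrix.charpoly_degree_eq_dim]; rfl
    rw [discr_of_degree_eq_two hdeg, Matrix.charpoly_fin_two]
    simp only [coeff_add, coeff_sub, coeff_C_mul, coeff_X_pow, coeff_C, coeff_X, Matrix.trace_fin_two, Matrix.det_fin_two]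
    norm_num
    ring
  refine ⟨key B, fun a => ?_⟩
  rw [key, key]
  simp only [Matrix.add_apply, Matrix.smul_apply, Matrix.one_apply_eq, Matrix.one_apply_ne (by decide : (0 : Fin 2) ≠ 1),
    Matrix.one_apply_ne (by decide : (1 : Fin 2) ≠ 0), smul_eq_mul, mul_one, mul_zero, zero_add]
  ring

end NormalForm

end Summit.HodgeConjecture.HodgeConjecture.Cruxes.H413.F0P3cStCharTSHCDescentSemisimpleAlg
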